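import Literature.Analysis.FluidPDE.PassiveScalarDiagMildBounds
import Literature.Analysis.FluidPDE.PassiveScalarDiagMildCoeff
import Literature.Analysis.FluidPDE.PassiveScalarDiagMildWeakMode
import HarnessLib

/-!
# Mild (Duhamel) formulation of the passive scalar equation with constant diagonal diffusion and
  bounded drift: square-integrable sources of the FORCED equation and their Fourier coefficients

Analysis/FluidPDE proof-support file (everything proved). For the forced equation
`∂ₜθ + div(uθ) = κ ∑ᵢ aᵢ ∂ᵢ∂ᵢθ + s` with a source `s ∈ L²((0,T) × T^d)` the mild (Duhamel)
formulation mode by mode reads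
`θ̂ₖ(t) = e^{-νₖt} θ̂₀(k) + ∫₀ᵗ e^{-νₖ(t-τ)} ŝ(τ)(k) dτ - ∫₀ᵗ e^{-νₖ(t-τ)} N(θ)(τ)(k) dτ`
(Pazy 1983, Ch. 4 §4.2, Def. 2.3 and the inhomogeneous problem Cor. 2.5). This file sets up the
class of sources `Torus.SourceL2 T s E_s` (jointly measurable on `(0,T) × T^d` with `∫₀ᵀ∫ s² ≤ E_s`,
i.e. `s ∈ L²((0,T) × T^d)`, `SourceL2.of_memLp`) and the time-dependent Fourier coefficients
`ŝ(τ)(k)` (`Torus.testCoeff s τ k`) of its slices: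

* a.e. slice is in `L²(T^d)`; `∫₀ᵀ∫ s² ≤ E_s` in real form; attenuation `e^{-λτ}s` stays in the class;
* `ŝ(·)(k) ∈ L¹(0,T)` (Fubini) and `∫₀ᵀ ∑_{k∈F} |ŝ(τ)(k)|² dτ ≤ E_s` (Bessel slice by slice);
* the slice Parseval tails `sourceTail F₀ τ = ∫ s(τ)² - ∑_{k∈F₀}|ŝ(τ)(k)|²` have time integrals
  tending to `0` along the frequency balls (dominated convergence).

The sequel `PassiveScalarDiagMildSourceDuhamel` builds the source Duhamel term
`∫₀ᵗ e^{-(νₖ+λ)(t-τ)} ŝ(τ)(k) dτ` on this.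

## References

* A. Pazy, *Semigroups of Linear Operators and Applications to PDE*, Springer 1983, Ch. 4 §4.2,
  (2.3), Def. 2.3, Cor. 2.5 (inhomogeneous initial value problem, mild solution).
* L. C. Evans, *Partial Differential Equations*, 2nd ed. (AMS 2010), §7.1.2 (Galerkin / energy estimates with `f ∈ L²(0,T;L²)`).
* L. Grafakos, *Classical Fourier Analysis*, 3rd ed. (2014), Prop. 3.2.6 (4), Prop. 3.2.7 (3).
-/

noncomputable section

open MeasureTheory TopologicalSpace Set Function Filter UnitAddTorus
open _root_.Topology
open scoped ENNReal NNReal InnerProductSpace ComplexConjugate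

namespace Literature.Analysis.FluidPDE

namespace Torus

open Literature.Analysis.FunctionSpaces.Torus Literature.Analysis.FunctionSpaces

variable {d : Type*} [Fintype d]

/-! ## Square-integrable sources on `(0,T) × T^d` -/

section Source

/-- **A square-integrable source on `(0,T) × T^d`** with the bound `E_s`: `s` is jointly (a.e.
strongly) measurable for the product of Lebesgue measure on `(0,T)` with the Haar probability
measure of `T^d`, and `∫₀ᵀ ∫ s(τ,x)² dx dτ ≤ E_s` (as an iterated lower Lebesgue integral) — the
content of `s ∈ L²((0,T) × T^d) = L²(0,T; L²(T^d))` (`SourceL2.of_memLp`), recorded with an explicit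
constant. [cite: Evans2010, §7.1.1 (f ∈ L²(0,T;L²(U))), §7.1.2 Thm. 2] -/
structure SourceL2 (T : ℝ) (s : ℝ → UnitAddTorus d → ℝ) (Es : ℝ) : Prop where
  /-- `0 ≤ E_s`. -/
  nonneg : 0 ≤ Es
  /-- Joint measurability on `(0,T) × T^d`. -/
  aestronglyMeasurable :
    AEStronglyMeasurable (uncurry s) (((volume : Measure ℝ).restrict (Ioo 0 T)).prod volume)
  /-- `∫₀ᵀ ∫ s² ≤ E_s`. -/
  lintegral_le : ∫⁻ τ in Ioo 0 T, ∫⁻ x, ‖s τ x‖ₑ ^ 2 ≤ ENNReal.ofReal Es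

namespace SourceL2

variable {T Es : ℝ} {s : ℝ → UnitAddTorus d → ℝ}

/-- **`s ∈ L²((0,T) × T^d)` gives a square-integrable source** with `E_s = ‖s‖²_{L²}`. [cite: Evans2010, §7.1.1 (f ∈ L²(0,T;L²(U))), §7.1.2 Thm. 2] -/
theorem of_memLp (hs : MemLp (uncurry s) 2 (((volume : Measure ℝ).restrict (Ioo 0 T)).prod volume)) :
    SourceL2 T s ((eLpNorm (uncurry s) 2 (((volume : Measure ℝ).restrict (Ioo 0 T)).prod volume)).toReal ^ 2) := by
  set μ := ((volume : Measure ℝ).restrict (Ioo 0 T)).prod (volume : Measure (UnitAddTorus d)) with hμ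
  have hprod : ∫⁻ τ in Ioo 0 T, ∫⁻ x, ‖s τ x‖ₑ ^ 2 = ∫⁻ p, ‖uncurry s p‖ₑ ^ 2 ∂μ := by
    rw [hμ, lintegral_prod _ (hs.1.aemeasurable.enorm.pow_const 2)]
    rfl
  refine ⟨sq_nonneg _, hs.1, ?_⟩
  rw [hprod, ← FunctionSpaces.eLpNorm_two_pow_two_eq_lintegral, ← ENNReal.toReal_pow,
    ENNReal.ofReal_toReal (ENNReal.pow_ne_top hs.eLpNorm_ne_top)]

/-- Monotonicity in the bound. [cite: Evans2010, §7.1.1 (f ∈ L²(0,T;L²(U))), §7.1.2 Thm. 2] -/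
theorem mono (h : SourceL2 T s Es) {Es' : ℝ} (hE : Es ≤ Es') : SourceL2 T s Es' :=
  ⟨h.nonneg.trans hE, h.aestronglyMeasurable, h.lintegral_le.trans (ENNReal.ofReal_le_ofReal hE)⟩

/-- The zero source. [cite: Evans2010, §7.1.1 (f ∈ L²(0,T;L²(U))), §7.1.2 Thm. 2] -/
theorem zero (T : ℝ) : SourceL2 T (fun _ _ => (0 : ℝ) : ℝ → UnitAddTorus d → ℝ) 0 := by
  refine ⟨le_rfl, (aestronglyMeasurable_const (b := (0 : ℝ))).congr (ae_of_all _ fun p => rfl), ?_⟩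
  simp

/-- The space–time square integral is finite. [cite: Evans2010, §7.1.1 (f ∈ L²(0,T;L²(U))), §7.1.2 Thm. 2] -/
theorem lintegral_lintegral_sq_lt_top (h : SourceL2 T s Es) : ∫⁻ τ in Ioo 0 T, ∫⁻ x, ‖s τ x‖ₑ ^ 2 < ∞ :=
  lt_of_le_of_lt h.lintegral_le ENNReal.ofReal_lt_top

/-- The source is in `L²((0,T) × T^d)`. [cite: Evans2010, §7.1.1 (f ∈ L²(0,T;L²(U))), §7.1.2 Thm. 2] -/
theorem memLp_uncurry (h : SourceL2 T s Es) :
    MemLp (uncurry s) 2 (((volume : Measure ℝ).restrict (Ioo 0 T)).prod (volume : Measure (UnitAddTorus d))) :=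
  (FunctionSpaces.Torus.memLp_two_uncurry h.aestronglyMeasurable h.lintegral_lintegral_sq_lt_top).1

/-- The source is integrable on `(0,T) × T^d` (finite measure). [cite: Evans2010, §7.1.1 (f ∈ L²(0,T;L²(U))), §7.1.2 Thm. 2] -/
theorem integrable_uncurry (h : SourceL2 T s Es) :
    Integrable (uncurry s) (((volume : Measure ℝ).restrict (Ioo 0 T)).prod (volume : Measure (UnitAddTorus d))) := by
  haveI : IsFiniteMeasure ((volume : Measure ℝ).restrict (Ioo 0 T)) :=
    isFiniteMeasure_restrict.2 measure_Ioo_lt_top.ne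
  exact h.memLp_uncurry.integrable one_le_two

/-- The space–time lift of the source is a.e. strongly measurable on `(0,T) × ℝ^d` (the
measurability clause of the forced weak class). [cite: Evans2010, §7.1.1 (f ∈ L²(0,T;L²(U))), §7.1.2 Thm. 2] -/
theorem aestronglyMeasurable_stLift (h : SourceL2 T s Es) :
    AEStronglyMeasurable (stLift s) (volume.restrict (Ioo 0 T ×ˢ (univ : Set (EuclideanSpace ℝ d)))) :=
  aestronglyMeasurable_stLift_of_uncurry h.aestronglyMeasurable

/-- `s ∈ L¹((0,T) × T^d)` in the iterated form of the forced weak class. [cite: Evans2010, §7.1.1 (f ∈ L²(0,T;L²(U))), §7.1.2 Thm. 2] -/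
theorem lintegral_lintegral_enorm_lt_top (h : SourceL2 T s Es) : ∫⁻ τ in Ioo 0 T, ∫⁻ x, ‖s τ x‖ₑ < ∞ := by
  have h1 := h.integrable_uncurry.2
  rw [hasFiniteIntegral_iff_enorm, lintegral_prod _ h.aestronglyMeasurable.aemeasurable.enorm] at h1
  exact h1

/-- **Almost every slice is square integrable**: for a.e. `τ ∈ (0,T)`, `s(τ) ∈ L²(T^d)`. [cite: Evans2010, §7.1.1 (f ∈ L²(0,T;L²(U))), §7.1.2 Thm. 2] -/
theorem ae_memLp_slice (h : SourceL2 T s Es) :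
    ∀ᵐ τ ∂((volume : Measure ℝ).restrict (Ioo 0 T)), MemLp (s τ) 2 (volume : Measure (UnitAddTorus d)) := by
  have hmeas : ∀ᵐ τ ∂((volume : Measure ℝ).restrict (Ioo 0 T)), AEStronglyMeasurable (s τ) volume :=
    h.aestronglyMeasurable.prodMk_left
  have hint : AEMeasurable (fun τ => ∫⁻ x, ‖s τ x‖ₑ ^ 2) ((volume : Measure ℝ).restrict (Ioo 0 T)) :=
    (h.aestronglyMeasurable.aemeasurable.enorm.pow_const 2).lintegral_prod_right'
  have hfin : ∀ᵐ τ ∂((volume : Measure ℝ).restrict (Ioo 0 T)), ∫⁻ x, ‖s τ x‖ₑ ^ 2 < ∞ :=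
    ae_lt_top' hint h.lintegral_lintegral_sq_lt_top.ne
  filter_upwards [hmeas, hfin] with τ hτ hτ'
  refine ⟨hτ, (eLpNorm_lt_top_iff_lintegral_rpow_enorm_lt_top two_ne_zero ENNReal.ofNat_ne_top).2 ?_⟩
  simpa only [ENNReal.toReal_ofNat, ENNReal.rpow_two] using hτ'

/-- `s²` is integrable on `(0,T) × T^d`. [cite: Evans2010, §7.1.1 (f ∈ L²(0,T;L²(U))), §7.1.2 Thm. 2] -/
theorem integrable_sq (h : SourceL2 T s Es) :
    Integrable (fun p : ℝ × UnitAddTorus d => (s p.1 p.2) ^ 2)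
      (((volume : Measure ℝ).restrict (Ioo 0 T)).prod (volume : Measure (UnitAddTorus d))) :=
  h.memLp_uncurry.integrable_sq

/-- The slice energies `τ ↦ ∫ s(τ)²` are integrable on `(0,T)`. [cite: Evans2010, §7.1.1 (f ∈ L²(0,T;L²(U))), §7.1.2 Thm. 2] -/
theorem integrable_integral_sq (h : SourceL2 T s Es) :
    Integrable (fun τ => ∫ x, (s τ x) ^ 2) ((volume : Measure ℝ).restrict (Ioo 0 T)) :=
  h.integrable_sq.integral_prod_left

/-- **The energy bound in real form**: `∫₀ᵀ ∫ s(τ)² dτ ≤ E_s`. [cite: Evans2010, §7.1.1 (f ∈ L²(0,T;L²(U))), §7.1.2 Thm. 2] -/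
theorem integral_integral_sq_le (h : SourceL2 T s Es) : ∫ τ in Ioo 0 T, ∫ x, (s τ x) ^ 2 ≤ Es := by
  have hae : ∀ᵐ τ ∂((volume : Measure ℝ).restrict (Ioo 0 T)),
      (∫ x, (s τ x) ^ 2) = (∫⁻ x, ‖s τ x‖ₑ ^ 2).toReal := by
    filter_upwards [h.ae_memLp_slice] with τ hτ
    rw [lintegral_enorm_sq_eq_ofReal_sq hτ, ENNReal.toReal_ofReal (integral_nonneg fun _ => sq_nonneg _)]
  have hint : AEMeasurable (fun τ => ∫⁻ x, ‖s τ x‖ₑ ^ 2) ((volume : Measure ℝ).restrict (Ioo 0 T)) :=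
    (h.aestronglyMeasurable.aemeasurable.enorm.pow_const 2).lintegral_prod_right'
  have hfin : ∀ᵐ τ ∂((volume : Measure ℝ).restrict (Ioo 0 T)), ∫⁻ x, ‖s τ x‖ₑ ^ 2 < ∞ :=
    ae_lt_top' hint h.lintegral_lintegral_sq_lt_top.ne
  rw [integral_congr_ae hae, integral_toReal hint hfin]
  exact ENNReal.toReal_le_of_le_ofReal h.nonneg h.lintegral_le

/-- Scaling by a bounded continuous time factor `|f| ≤ 1` keeps the class and the bound. [cite: Evans2010, §7.1.1 (f ∈ L²(0,T;L²(U))), §7.1.2 Thm. 2] -/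
theorem mul_left (h : SourceL2 T s Es) {f : ℝ → ℝ} (hf : Continuous f) (hf1 : ∀ τ ∈ Ioo 0 T, |f τ| ≤ 1) :
    SourceL2 T (fun τ x => f τ * s τ x) Es := by
  refine ⟨h.nonneg, ((hf.comp continuous_fst).aestronglyMeasurable).mul h.aestronglyMeasurable, ?_⟩
  refine le_trans (setLIntegral_mono' measurableSet_Ioo fun τ hτ => ?_) h.lintegral_le
  refine lintegral_mono fun x => ?_
  dsimp only
  rw [enorm_mul]
  have hle : ‖f τ‖ₑ * ‖s τ x‖ₑ ≤ ‖s τ x‖ₑ := by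
    calc ‖f τ‖ₑ * ‖s τ x‖ₑ ≤ 1 * ‖s τ x‖ₑ := by
          gcongr
          rw [← ofReal_norm, Real.norm_eq_abs, ← ENNReal.ofReal_one]
          exact ENNReal.ofReal_le_ofReal (hf1 τ hτ)
      _ = ‖s τ x‖ₑ := one_mul _
  gcongr

/-- The exponentially attenuated source `e^{-λτ} s(τ)` (`λ ≥ 0`) is in the class with the same bound. [cite: Pazy1983, Ch. 4 §4.2, (2.3) and Def. 2.3 (mild solution), p. 106] -/
theorem exp_neg_mul (h : SourceL2 T s Es) {lam : ℝ} (hlam : 0 ≤ lam) :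
    SourceL2 T (fun τ x => Real.exp (-(lam * τ)) * s τ x) Es := by
  refine h.mul_left (by fun_prop) fun τ hτ => ?_
  rw [abs_of_nonneg (Real.exp_pos _).le, Real.exp_le_one_iff, neg_nonpos]
  exact mul_nonneg hlam hτ.1.le

end SourceL2

end Source

/-! ## The Fourier coefficients of the source: integrability in time, Bessel, tails -/

section SourceCoeff

variable {T Es : ℝ} {s : ℝ → UnitAddTorus d → ℝ}

/-- Scaling the source by a time factor scales its slice coefficients: `𝓕(f(τ)s(τ))(k) = f(τ) ŝ(τ)(k)`. [cite: Grafakos2014, Prop. 3.2.6 (4)] -/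
theorem testCoeff_mul_left (f : ℝ → ℝ) (s : ℝ → UnitAddTorus d → ℝ) (τ : ℝ) (k : d → ℤ) :
    testCoeff (fun τ x => f τ * s τ x) τ k = (f τ : ℂ) * testCoeff s τ k := by
  rw [testCoeff_apply, testCoeff_apply]
  have e : (fun x => (((fun τ x => f τ * s τ x) τ x : ℝ) : ℂ)) = (f τ : ℂ) • fun x => ((s τ x : ℝ) : ℂ) := by
    funext x; simp only [Pi.smul_apply, smul_eq_mul]; push_cast; ring
  rw [e, mFourierCoeff_const_smul, smul_eq_mul]

/-- Conjugate symmetry of the slice coefficients of a real source: `ŝ(τ)(-k) = conj (ŝ(τ)(k))`. [cite: Grafakos2014, Prop. 3.2.6 (4)] -/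
theorem testCoeff_neg (s : ℝ → UnitAddTorus d → ℝ) (τ : ℝ) (k : d → ℤ) :
    testCoeff s τ (-k) = conj (testCoeff s τ k) := by
  rw [testCoeff_apply, testCoeff_apply, mFourierCoeff_ofReal_comp]

/-- The character-weighted source `e_{-k}(x) s(τ,x)` is integrable on `(0,T) × T^d`. [cite: Grafakos2014, Prop. 3.2.7 (3)] -/
theorem integrable_mFourier_smul_source (h : SourceL2 T s Es) (k : d → ℤ) :
    Integrable (fun p : ℝ × UnitAddTorus d => mFourier (-k) p.2 • (((s p.1 p.2 : ℝ) : ℂ)))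
      (((volume : Measure ℝ).restrict (Ioo 0 T)).prod volume) := by
  have h1 : Integrable (fun p : ℝ × UnitAddTorus d => (((s p.1 p.2 : ℝ) : ℂ)))
      (((volume : Measure ℝ).restrict (Ioo 0 T)).prod volume) := h.integrable_uncurry.ofReal
  refine h1.bdd_smul 1 ((mFourier (-k)).continuous.comp continuous_snd).aestronglyMeasurable ?_
  exact Eventually.of_forall fun p => ((mFourier (-k)).norm_coe_le_norm p.2).trans_eq mFourier_norm

/-- **The slice coefficients `τ ↦ ŝ(τ)(k)` are integrable in time** on `(0,T)` (Fubini). [cite: Grafakos2014, Prop. 3.2.7 (3)] -/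
theorem integrable_testCoeff_source (h : SourceL2 T s Es) (k : d → ℤ) :
    Integrable (fun τ => testCoeff s τ k) ((volume : Measure ℝ).restrict (Ioo 0 T)) := by
  have h1 := (integrable_mFourier_smul_source h k).integral_prod_left
  refine h1.congr (ae_of_all _ fun τ => ?_)
  dsimp only
  rw [testCoeff_apply, mFourierCoeff_eq_integral_volume]

/-- **Bessel at almost every slice**: for a.e. `τ ∈ (0,T)` and every finite frequency set,
`∑_{k∈F} |ŝ(τ)(k)|² ≤ ∫ s(τ)²`. [cite: Grafakos2014, Prop. 3.2.7 (3)] -/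
theorem ae_sum_sq_norm_testCoeff_le (h : SourceL2 T s Es) :
    ∀ᵐ τ ∂((volume : Measure ℝ).restrict (Ioo 0 T)), ∀ F : Finset (d → ℤ),
      ∑ k ∈ F, ‖testCoeff s τ k‖ ^ 2 ≤ ∫ x, (s τ x) ^ 2 := by
  filter_upwards [h.ae_memLp_slice] with τ hτ F
  simp only [testCoeff_apply]
  exact sum_le_hasSum F (fun _ _ => sq_nonneg _) (hasSum_sq_norm_mFourierCoeff_ofReal hτ)

/-- Single-mode Bessel at almost every slice: `|ŝ(τ)(k)|² ≤ ∫ s(τ)²`. [cite: Grafakos2014, Prop. 3.2.7 (3)] -/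
theorem ae_sq_norm_testCoeff_le (h : SourceL2 T s Es) :
    ∀ᵐ τ ∂((volume : Measure ℝ).restrict (Ioo 0 T)), ∀ k : d → ℤ,
      ‖testCoeff s τ k‖ ^ 2 ≤ ∫ x, (s τ x) ^ 2 := by
  filter_upwards [ae_sum_sq_norm_testCoeff_le h] with τ hτ k
  simpa using hτ {k}

/-- `τ ↦ |ŝ(τ)(k)|²` is integrable on `(0,T)`. [cite: Grafakos2014, Prop. 3.2.7 (3)] -/
theorem integrable_sq_norm_testCoeff (h : SourceL2 T s Es) (k : d → ℤ) :
    Integrable (fun τ => ‖testCoeff s τ k‖ ^ 2) ((volume : Measure ℝ).restrict (Ioo 0 T)) := by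
  refine h.integrable_integral_sq.mono' ((integrable_testCoeff_source h k).aestronglyMeasurable.norm.pow 2) ?_
  filter_upwards [ae_sq_norm_testCoeff_le h] with τ hτ
  rw [Real.norm_of_nonneg (sq_nonneg _)]
  exact hτ k

/-- **The time-integrated Bessel inequality**: `∫₀ᵀ ∑_{k∈F} |ŝ(τ)(k)|² dτ ≤ E_s`. [cite: Grafakos2014, Prop. 3.2.7 (3)] -/
theorem integral_sum_sq_norm_testCoeff_le (h : SourceL2 T s Es) (F : Finset (d → ℤ)) :
    ∫ τ in Ioo 0 T, ∑ k ∈ F, ‖testCoeff s τ k‖ ^ 2 ≤ Es := by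
  refine le_trans ?_ h.integral_integral_sq_le
  refine integral_mono_ae (integrable_finsetSum _ fun k _ => integrable_sq_norm_testCoeff h k)
    h.integrable_integral_sq ?_
  filter_upwards [ae_sum_sq_norm_testCoeff_le h] with τ hτ
  exact hτ F

/-- The **source tail** beyond a finite frequency set `F₀` at time `τ`:
`∫ s(τ)² - ∑_{k∈F₀} |ŝ(τ)(k)|²` — by Parseval the sum over `k ∉ F₀` of `|ŝ(τ)(k)|²` (at a.e. time). [cite: Grafakos2014, Prop. 3.2.7 (3)] -/
def sourceTail (s : ℝ → UnitAddTorus d → ℝ) (F₀ : Finset (d → ℤ)) (τ : ℝ) : ℝ :=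
  (∫ x, (s τ x) ^ 2) - ∑ k ∈ F₀, ‖testCoeff s τ k‖ ^ 2

/-- Unfolding `sourceTail`. [cite: Grafakos2014, Prop. 3.2.7 (3)] -/
theorem sourceTail_apply (s : ℝ → UnitAddTorus d → ℝ) (F₀ : Finset (d → ℤ)) (τ : ℝ) :
    sourceTail s F₀ τ = (∫ x, (s τ x) ^ 2) - ∑ k ∈ F₀, ‖testCoeff s τ k‖ ^ 2 := rfl

/-- For a.e. `τ ∈ (0,T)`: the coefficients summed over `F \ F₀` are at most the tail beyond `F₀`
(Bessel on `(F \ F₀) ∪ F₀`). [cite: Grafakos2014, Prop. 3.2.7 (3)] -/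
theorem ae_sum_sdiff_sq_norm_testCoeff_le_sourceTail (h : SourceL2 T s Es) (F₀ : Finset (d → ℤ)) :
    ∀ᵐ τ ∂((volume : Measure ℝ).restrict (Ioo 0 T)), ∀ F : Finset (d → ℤ),
      ∑ k ∈ F \ F₀, ‖testCoeff s τ k‖ ^ 2 ≤ sourceTail s F₀ τ := by
  filter_upwards [ae_sum_sq_norm_testCoeff_le h] with τ hτ F
  rw [sourceTail_apply, le_sub_iff_add_le, ← Finset.sum_union Finset.sdiff_disjoint]
  exact hτ _

/-- For a.e. `τ ∈ (0,T)`: `0 ≤ sourceTail ≤ ∫ s(τ)²`. [cite: Grafakos2014, Prop. 3.2.7 (3)] -/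
theorem ae_sourceTail_mem_Icc (h : SourceL2 T s Es) (F₀ : Finset (d → ℤ)) :
    ∀ᵐ τ ∂((volume : Measure ℝ).restrict (Ioo 0 T)),
      0 ≤ sourceTail s F₀ τ ∧ sourceTail s F₀ τ ≤ ∫ x, (s τ x) ^ 2 := by
  filter_upwards [ae_sum_sq_norm_testCoeff_le h] with τ hτ
  refine ⟨?_, ?_⟩
  · rw [sourceTail_apply, sub_nonneg]; exact hτ F₀
  · rw [sourceTail_apply, sub_le_self_iff]; exact Finset.sum_nonneg fun _ _ => sq_nonneg _

/-- The source tail is integrable in time on `(0,T)`. [cite: Grafakos2014, Prop. 3.2.7 (3)] -/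
theorem integrable_sourceTail (h : SourceL2 T s Es) (F₀ : Finset (d → ℤ)) :
    Integrable (sourceTail s F₀) ((volume : Measure ℝ).restrict (Ioo 0 T)) := by
  have e : sourceTail s F₀ = fun τ => (∫ x, (s τ x) ^ 2) - ∑ k ∈ F₀, ‖testCoeff s τ k‖ ^ 2 := rfl
  rw [e]
  exact h.integrable_integral_sq.sub (integrable_finsetSum _ fun k _ => integrable_sq_norm_testCoeff h k)

/-- **The source tails are uniformly small in time-mean**: along the frequency balls,
`∫₀ᵀ sourceTail(freqBall N) → 0` (dominated convergence in time; at a.e. `τ` the tail is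
`‖s(τ) - P_N s(τ)‖²_{L²} → 0` by Parseval, `Torus.tendsto_integral_sq_sub_scalarTruncate`). [cite: Grafakos2014, Prop. 3.2.7 (3)] -/
theorem tendsto_integral_sourceTail [DecidableEq d] (h : SourceL2 T s Es) :
    Tendsto (fun N => ∫ τ in Ioo 0 T, sourceTail s (freqBall N) τ) atTop (𝓝 0) := by
  have hlim : ∀ᵐ τ ∂((volume : Measure ℝ).restrict (Ioo 0 T)),
      Tendsto (fun N => sourceTail s (freqBall N) τ) atTop (𝓝 0) := by
    filter_upwards [h.ae_memLp_slice] with τ hτ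
    have e : ∀ N, sourceTail s (freqBall N) τ = ∫ x, (s τ x - scalarTruncate N (s τ) x) ^ 2 := by
      intro N
      rw [sourceTail_apply, integral_sq_sub_scalarTruncate hτ N]
      simp only [testCoeff_apply]
    simp_rw [e]
    exact tendsto_integral_sq_sub_scalarTruncate hτ
  have hbound : ∀ N, ∀ᵐ τ ∂((volume : Measure ℝ).restrict (Ioo 0 T)),
      ‖sourceTail s (freqBall N) τ‖ ≤ ∫ x, (s τ x) ^ 2 := by
    intro N
    filter_upwards [ae_sourceTail_mem_Icc h (freqBall N)] with τ hτ
    rw [Real.norm_of_nonneg hτ.1]; exact hτ.2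
  have := tendsto_integral_of_dominated_convergence (fun τ => ∫ x, (s τ x) ^ 2)
    (fun N => (integrable_sourceTail h (freqBall N)).aestronglyMeasurable) h.integrable_integral_sq hbound hlim
  simpa using this

end SourceCoeff

end Torus

end Literature.Analysis.FluidPDE

end
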